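import Mathlib
import Summits.FinalStateConjecture.FinalStateConjecture.Theorems.EIHFluxBalanceModulatedKerrHandoffDragDefectDragError
import Summits.FinalStateConjecture.FinalStateConjecture.Theorems.EIHFluxBalanceModulatedKerrHandoffDragDefectTaylorSecond

/-!
# Route EIHFluxBalance — `ModulatedKerrHandoff`, stub `stub_dragDefect`: the jets of the drag error,
# second order, and of the pulled-back perturbation

Helper file for the crux `stmt-FinalStateConjecture-10167`
(`Summit.FinalStateConjecture.FinalStateConjecture.Theses.EIHFluxBalance.ModulatedKerrHandoff`),
line `overlap-modulation-second-iterate`, stub `stub_dragDefect`. Continuation of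
`…DragDefectDragError` (notation as there: `h` a form field smooth on the ball `B(x, r)`, drag `A`
with `x + Ax ∈ B`, `‖A‖ ≤ 1`, `Nₖ ≥ sup_B ‖Dᵏh‖`, `a = ‖A‖`, `b = ‖Ax‖`):

* `norm_iteratedFDeriv_two_dragError_apply_le` — `‖D²(E(·)(v,w))(x)‖ ≤ (N₄b² + 4N₃ab + 11N₂a²)‖v‖‖w‖`;
* `norm_iteratedFDeriv_dragError_le` — **the three jets of the drag error `E` at `x` are quadratic
  in `A`**: `‖E(x)‖ ≤ N₂b² + 2N₁ab + N₀a²`, `‖D¹E(x)‖ ≤ N₃b² + 3N₂ab + 4N₁a²`,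
  `‖D²E(x)‖ ≤ N₄b² + 4N₃ab + 11N₂a²`;
* `norm_iteratedFDeriv_pullback_le` — the pulled-back perturbation `((1+A)^*h)(y) = h(y+Ay)((1+A)·,(1+A)·)`
  has `‖Dʲ((1+A)^*h)(x)‖ ≤ 4·2ʲ Nⱼ` (`j ≤ 2`).
-/

noncomputable section

-- `Summit.<S>.<S>.…` (single-problem summit, D-0017) trips core's duplicate-namespace linter.
set_option linter.dupNamespace false
set_option maxSynthPendingDepth 3

open Set Function Filter Metric ContinuousLinearMap Literature.Geometry.Lorentzian
open scoped Topology ContDiff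

namespace Summit.FinalStateConjecture.FinalStateConjecture.Theorems

namespace DragDefect

section Bounds

variable {h : E4 → E4 →L[ℝ] E4 →L[ℝ] ℝ} {A : E4 →L[ℝ] E4} {x : E4} {r N₀ N₁ N₂ N₃ N₄ : ℝ}

/-- **Second jet of the components of the drag error**:
`‖D²(E(·)(v,w))(x)‖ ≤ (N₄ ‖Ax‖² + 4 N₃ ‖A‖ ‖Ax‖ + 11 N₂ ‖A‖²) ‖v‖ ‖w‖` (`‖A‖ ≤ 1`). [folklore] -/
theorem norm_iteratedFDeriv_two_dragError_apply_le (hh : ContDiffOn ℝ ∞ h (ball x r))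
    (hx : x ∈ ball x r) (hAx : x + A x ∈ ball x r) (hA : ‖A‖ ≤ 1)
    (h1 : ∀ z ∈ ball x r, ‖iteratedFDeriv ℝ 1 h z‖ ≤ N₁)
    (h2 : ∀ z ∈ ball x r, ‖iteratedFDeriv ℝ 2 h z‖ ≤ N₂)
    (h3 : ∀ z ∈ ball x r, ‖iteratedFDeriv ℝ 3 h z‖ ≤ N₃)
    (h4 : ∀ z ∈ ball x r, ‖iteratedFDeriv ℝ 4 h z‖ ≤ N₄) (v w : E4) :
    ‖iteratedFDeriv ℝ 2 (fun y ↦ (h y + fderiv ℝ h y (A y) + (h y).comp A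
        + (ContinuousLinearMap.precomp ℝ A).comp (h y)
        - (h (y + A y)).bilinearComp (ContinuousLinearMap.id ℝ E4 + A)
            (ContinuousLinearMap.id ℝ E4 + A)) v w) x‖ ≤
      (N₄ * ‖A x‖ ^ 2 + 4 * N₃ * ‖A‖ * ‖A x‖ + 11 * N₂ * ‖A‖ ^ 2) * ‖v‖ * ‖w‖ := by
  rw [((dragError_apply_eventuallyEq hh hx v w).iteratedFDeriv ℝ 2).eq_of_nhds,
    ← norm_iteratedFDeriv_fderiv, norm_iteratedFDeriv_one]
  have hN₂ : 0 ≤ N₂ := (norm_nonneg _).trans (h2 x hx)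
  have hN₃ : 0 ≤ N₃ := (norm_nonneg _).trans (h3 x hx)
  have ha : 0 ≤ ‖A‖ := norm_nonneg _
  obtain ⟨-, b2, b3, b4⟩ := scalar_sup_bounds hh h1 h2 h3 h4 v w
  obtain ⟨-, c2, c3, -⟩ := scalar_sup_bounds hh h1 h2 h3 h4 (A v) w
  obtain ⟨-, d2, d3, -⟩ := scalar_sup_bounds hh h1 h2 h3 h4 v (A w)
  obtain ⟨-, e2, -, -⟩ := scalar_sup_bounds hh h1 h2 h3 h4 (A v) (A w)
  have hU : IsOpen (ball x r) := isOpen_ball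
  have hC : Convex ℝ (ball x r) := convex_ball x r
  have hψ := contDiffOn_apply₂ hh v w
  have hψ₁ := contDiffOn_apply₂ hh (A v) w
  have hψ₂ := contDiffOn_apply₂ hh v (A w)
  have hψ₃ := contDiffOn_apply₂ hh (A v) (A w)
  -- the first derivative near `x` in closed form
  have hopen : IsOpen {y : E4 | y ∈ ball x r ∧ y + A y ∈ ball x r} :=
    hU.inter (hU.preimage (continuous_id.add A.continuous))
  have hev : fderiv ℝ (fun y ↦ -((fun z ↦ h z v w) (y + A y) - (fun z ↦ h z v w) y
          - fderiv ℝ (fun z ↦ h z v w) y (A y))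
        - ((fun z ↦ h z (A v) w) (y + A y) - (fun z ↦ h z (A v) w) y)
        - ((fun z ↦ h z v (A w)) (y + A y) - (fun z ↦ h z v (A w)) y)
        - (fun z ↦ h z (A v) (A w)) (y + A y)) =ᶠ[𝓝 x]
      fun y ↦ -fderiv ℝ (fun y ↦ (fun z ↦ h z v w) (y + A y) - (fun z ↦ h z v w) y
            - fderiv ℝ (fun z ↦ h z v w) y (A y)) y
          - fderiv ℝ (fun y ↦ (fun z ↦ h z (A v) w) (y + A y) - (fun z ↦ h z (A v) w) y) y
          - fderiv ℝ (fun y ↦ (fun z ↦ h z v (A w)) (y + A y) - (fun z ↦ h z v (A w)) y) y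
          - fderiv ℝ (fun y ↦ (fun z ↦ h z (A v) (A w)) (y + A y)) y := by
    filter_upwards [hopen.mem_nhds ⟨hx, hAx⟩] with y hy
    have dS := hasFDerivAt_rem hU hψ hy.1 hy.2 (A := A)
    have dΔ₁ := hasFDerivAt_delta hU hψ₁ hy.1 hy.2 (A := A)
    have dΔ₂ := hasFDerivAt_delta hU hψ₂ hy.1 hy.2 (A := A)
    have dC := hasFDerivAt_comp_affine hU hψ₃ hy.2 (A := A)
    have hT : HasFDerivAt (fun y ↦ -((fun z ↦ h z v w) (y + A y) - (fun z ↦ h z v w) y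
          - fderiv ℝ (fun z ↦ h z v w) y (A y))
        - ((fun z ↦ h z (A v) w) (y + A y) - (fun z ↦ h z (A v) w) y)
        - ((fun z ↦ h z v (A w)) (y + A y) - (fun z ↦ h z v (A w)) y)
        - (fun z ↦ h z (A v) (A w)) (y + A y)) _ y :=
      ((dS.neg.sub dΔ₁).sub dΔ₂).sub dC
    rw [hT.fderiv, dS.fderiv, dΔ₁.fderiv, dΔ₂.fderiv, dC.fderiv]
  rw [hev.fderiv_eq]
  -- the second derivatives of the four pieces
  have dS₂ := hasFDerivAt_fderiv_rem hU hψ hx hAx (A := A)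
  have dΔ₁₂ := hasFDerivAt_fderiv_delta hU hψ₁ hx hAx (A := A)
  have dΔ₂₂ := hasFDerivAt_fderiv_delta hU hψ₂ hx hAx (A := A)
  have dC₂ := hasFDerivAt_fderiv_comp_affine hU hψ₃ hAx (A := A)
  have hT₂ : HasFDerivAt (fun y ↦ -fderiv ℝ (fun y ↦ (fun z ↦ h z v w) (y + A y)
            - (fun z ↦ h z v w) y - fderiv ℝ (fun z ↦ h z v w) y (A y)) y
          - fderiv ℝ (fun y ↦ (fun z ↦ h z (A v) w) (y + A y) - (fun z ↦ h z (A v) w) y) y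
          - fderiv ℝ (fun y ↦ (fun z ↦ h z v (A w)) (y + A y) - (fun z ↦ h z v (A w)) y) y
          - fderiv ℝ (fun y ↦ (fun z ↦ h z (A v) (A w)) (y + A y)) y) _ x :=
    ((dS₂.neg.sub dΔ₁₂).sub dΔ₂₂).sub dC₂
  rw [hT₂.fderiv]
  -- pointwise bounds of the four second derivatives
  have nS := norm_fderiv_fderiv_rem_apply_le hU hC hψ hx hAx b2 b3 b4 (A := A)
  have nΔ₁ := norm_fderiv_fderiv_delta_apply_le hU hC hψ₁ hx hAx c2 c3 (A := A)
  have nΔ₂ := norm_fderiv_fderiv_delta_apply_le hU hC hψ₂ hx hAx d2 d3 (A := A)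
  have nC := norm_fderiv_fderiv_comp_affine_apply_le hU hψ₃ hAx e2 (A := A)
  rw [dS₂.fderiv] at nS
  rw [dΔ₁₂.fderiv] at nΔ₁
  rw [dΔ₂₂.fderiv] at nΔ₂
  rw [dC₂.fderiv] at nC
  have hN₄ : 0 ≤ N₄ := (norm_nonneg _).trans (h4 x hx)
  have hAv : ‖A v‖ ≤ ‖A‖ * ‖v‖ := le_opNorm _ _
  have hAw : ‖A w‖ ≤ ‖A‖ * ‖w‖ := le_opNorm _ _
  have hK : 0 ≤ (N₄ * ‖A x‖ ^ 2 + 4 * N₃ * ‖A‖ * ‖A x‖ + 11 * N₂ * ‖A‖ ^ 2) * ‖v‖ * ‖w‖ := by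
    have := norm_nonneg (A x); have := norm_nonneg v; have := norm_nonneg w
    positivity
  refine opNorm_le_bound₂ _ hK fun p q ↦ ?_
  simp only [_root_.sub_apply, _root_.neg_apply]
  have hsum := norm_sub_le_of_le (norm_sub_le_of_le (norm_sub_le_of_le
    ((norm_neg _).le.trans (nS p q)) (nΔ₁ p q)) (nΔ₂ p q)) (nC p q)
  refine hsum.trans ?_
  -- scalar arithmetic on the atoms
  have hp := norm_nonneg p
  have hq := norm_nonneg q
  have hb := norm_nonneg (A x)
  have hv := norm_nonneg v
  have hw := norm_nonneg w
  have hαn := norm_nonneg (A v)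
  have hβn := norm_nonneg (A w)
  generalize ‖A v‖ = α at hAv hαn ⊢
  generalize ‖A w‖ = β at hAw hβn ⊢
  generalize ‖A‖ = a at hA ha hAv hAw ⊢
  generalize ‖A x‖ = b at hb ⊢
  generalize ‖p‖ = P at hp ⊢
  generalize ‖q‖ = Q at hq ⊢
  generalize ‖v‖ = V at hv hAv ⊢
  generalize ‖w‖ = W at hw hAw ⊢
  clear nS nΔ₁ nΔ₂ nC hT₂ dS₂ dΔ₁₂ dΔ₂₂ dC₂ hev b2 b3 b4 c2 c3 d2 d3 e2 hK
  have h3a : 2 * a + a ^ 2 ≤ 3 * a := by nlinarith only [hA, ha]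
  have h4a : (1 + a) ^ 2 ≤ 4 := by nlinarith only [hA, ha]
  have i1 : N₃ * α * W * b ≤ N₃ * (a * V) * W * b := by gcongr
  have i2 : N₂ * α * W * (2 * a + a ^ 2) ≤ N₂ * (a * V) * W * (3 * a) := by gcongr
  have i3 : N₃ * V * β * b ≤ N₃ * V * (a * W) * b := by gcongr
  have i4 : N₂ * V * β * (2 * a + a ^ 2) ≤ N₂ * V * (a * W) * (3 * a) := by gcongr
  have i5 : N₂ * α * β * (1 + a) ^ 2 ≤ N₂ * (a * V) * (a * W) * 4 := by gcongr
  have hPQ : 0 ≤ P * Q := mul_nonneg hp hq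
  have key := mul_le_mul_of_nonneg_right (add_le_add (add_le_add (add_le_add (add_le_add i1 i2)
    i3) i4) i5) hPQ
  linarith only [hsum, key]

/-- **The jets of the drag error at `x` are quadratic in `A`**: with `Nₖ ≥ sup_B ‖Dᵏh‖`,
`a = ‖A‖ ≤ 1`, `b = ‖Ax‖`: `‖E(x)‖ ≤ N₂b² + 2N₁ab + N₀a²`, `‖D¹E(x)‖ ≤ N₃b² + 3N₂ab + 4N₁a²`,
`‖D²E(x)‖ ≤ N₄b² + 4N₃ab + 11N₂a²`. [folklore] -/
theorem norm_iteratedFDeriv_dragError_le (hh : ContDiffOn ℝ ∞ h (ball x r)) (hx : x ∈ ball x r)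
    (hAx : x + A x ∈ ball x r) (hA : ‖A‖ ≤ 1) (h0 : ∀ z ∈ ball x r, ‖h z‖ ≤ N₀)
    (h1 : ∀ z ∈ ball x r, ‖iteratedFDeriv ℝ 1 h z‖ ≤ N₁)
    (h2 : ∀ z ∈ ball x r, ‖iteratedFDeriv ℝ 2 h z‖ ≤ N₂)
    (h3 : ∀ z ∈ ball x r, ‖iteratedFDeriv ℝ 3 h z‖ ≤ N₃)
    (h4 : ∀ z ∈ ball x r, ‖iteratedFDeriv ℝ 4 h z‖ ≤ N₄) :
    ‖(fun y ↦ h y + fderiv ℝ h y (A y) + (h y).comp A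
        + (ContinuousLinearMap.precomp ℝ A).comp (h y)
        - (h (y + A y)).bilinearComp (ContinuousLinearMap.id ℝ E4 + A)
            (ContinuousLinearMap.id ℝ E4 + A)) x‖ ≤
      N₂ * ‖A x‖ ^ 2 + 2 * N₁ * ‖A‖ * ‖A x‖ + N₀ * ‖A‖ ^ 2 ∧
    ‖iteratedFDeriv ℝ 1 (fun y ↦ h y + fderiv ℝ h y (A y) + (h y).comp A
        + (ContinuousLinearMap.precomp ℝ A).comp (h y)
        - (h (y + A y)).bilinearComp (ContinuousLinearMap.id ℝ E4 + A)
            (ContinuousLinearMap.id ℝ E4 + A)) x‖ ≤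
      N₃ * ‖A x‖ ^ 2 + 3 * N₂ * ‖A‖ * ‖A x‖ + 4 * N₁ * ‖A‖ ^ 2 ∧
    ‖iteratedFDeriv ℝ 2 (fun y ↦ h y + fderiv ℝ h y (A y) + (h y).comp A
        + (ContinuousLinearMap.precomp ℝ A).comp (h y)
        - (h (y + A y)).bilinearComp (ContinuousLinearMap.id ℝ E4 + A)
            (ContinuousLinearMap.id ℝ E4 + A)) x‖ ≤
      N₄ * ‖A x‖ ^ 2 + 4 * N₃ * ‖A‖ * ‖A x‖ + 11 * N₂ * ‖A‖ ^ 2 := by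
  have hE := contDiffAt_dragError hh hx hAx (A := A)
  have hN₀ : 0 ≤ N₀ := (norm_nonneg _).trans (h0 x hx)
  have hN₁ : 0 ≤ N₁ := (norm_nonneg _).trans (h1 x hx)
  have hN₂ : 0 ≤ N₂ := (norm_nonneg _).trans (h2 x hx)
  have hN₃ : 0 ≤ N₃ := (norm_nonneg _).trans (h3 x hx)
  have hN₄ : 0 ≤ N₄ := (norm_nonneg _).trans (h4 x hx)
  have hb := norm_nonneg (A x)
  have ha := norm_nonneg A
  refine ⟨?_, ?_, ?_⟩
  · have h := norm_iteratedFDeriv_le_of_forall_apply₂ (m := 0) (hE.of_le (WithTop.coe_le_coe.mpr le_top))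
      (C := N₂ * ‖A x‖ ^ 2 + 2 * N₁ * ‖A‖ * ‖A x‖ + N₀ * ‖A‖ ^ 2) (by positivity) fun v w ↦ by
        rw [norm_iteratedFDeriv_zero]
        exact abs_dragError_apply_le hh hx hAx h0 h1 h2 h3 h4 v w
    rwa [norm_iteratedFDeriv_zero] at h
  · exact norm_iteratedFDeriv_le_of_forall_apply₂ (m := 1) (hE.of_le (WithTop.coe_le_coe.mpr le_top))
      (by positivity) fun v w ↦ norm_fderiv_dragError_apply_le hh hx hAx hA h1 h2 h3 h4 v w
  · exact norm_iteratedFDeriv_le_of_forall_apply₂ (m := 2) (hE.of_le (WithTop.coe_le_coe.mpr le_top))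
      (by positivity) fun v w ↦
        norm_iteratedFDeriv_two_dragError_apply_le hh hx hAx hA h1 h2 h3 h4 v w

end Bounds

/-! ### The jets of the pulled-back perturbation -/

section Pullback

variable {h : E4 → E4 →L[ℝ] E4 →L[ℝ] ℝ} {A : E4 →L[ℝ] E4} {x : E4} {r N₀ N₁ N₂ : ℝ}

/-- `‖(1 + A) v‖ ≤ (1 + ‖A‖) ‖v‖`. [folklore] -/
theorem norm_id_add_apply_le (A : E4 →L[ℝ] E4) (v : E4) :
    ‖(ContinuousLinearMap.id ℝ E4 + A) v‖ ≤ (1 + ‖A‖) * ‖v‖ := by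
  rw [_root_.add_apply, id_apply, add_mul, one_mul]
  exact norm_add_le_of_le le_rfl (le_opNorm _ _)

/-- The pulled-back perturbation is `C^∞` at `x`. [folklore] -/
theorem contDiffAt_pullback (hh : ContDiffOn ℝ ∞ h (ball x r)) (hAx : x + A x ∈ ball x r) :
    ContDiffAt ℝ ∞ (fun y ↦ (h (y + A y)).bilinearComp (ContinuousLinearMap.id ℝ E4 + A)
      (ContinuousLinearMap.id ℝ E4 + A)) x := by
  have hcomp : ContDiffAt ℝ ∞ (fun y ↦ h (y + A y)) x :=
    ((hh _ hAx).contDiffAt (isOpen_ball.mem_nhds hAx)).comp x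
      (contDiffAt_id.add A.contDiff.contDiffAt)
  have e : (fun y ↦ (h (y + A y)).bilinearComp (ContinuousLinearMap.id ℝ E4 + A)
      (ContinuousLinearMap.id ℝ E4 + A)) = fun y ↦
      (ContinuousLinearMap.precomp ℝ (ContinuousLinearMap.id ℝ E4 + A)).comp
        ((h (y + A y)).comp (ContinuousLinearMap.id ℝ E4 + A)) := by
    funext y; ext v w; rfl
  rw [e]
  exact contDiffAt_const.clm_comp (hcomp.clm_comp contDiffAt_const)

/-- **The jets of the pulled-back perturbation `((1+A)^*h)(y) = h(y+Ay)((1+A)·,(1+A)·)` at `x`**: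
`‖(1+A)^*h(x)‖ ≤ 4 N₀`, `‖D¹((1+A)^*h)(x)‖ ≤ 8 N₁`, `‖D²((1+A)^*h)(x)‖ ≤ 16 N₂` for `‖A‖ ≤ 1`.
[folklore] -/
theorem norm_iteratedFDeriv_pullback_le (hh : ContDiffOn ℝ ∞ h (ball x r)) (hx : x ∈ ball x r)
    (hAx : x + A x ∈ ball x r) (hA : ‖A‖ ≤ 1) (h0 : ∀ z ∈ ball x r, ‖h z‖ ≤ N₀)
    (h1 : ∀ z ∈ ball x r, ‖iteratedFDeriv ℝ 1 h z‖ ≤ N₁)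
    (h2 : ∀ z ∈ ball x r, ‖iteratedFDeriv ℝ 2 h z‖ ≤ N₂) :
    ‖(fun y ↦ (h (y + A y)).bilinearComp (ContinuousLinearMap.id ℝ E4 + A)
        (ContinuousLinearMap.id ℝ E4 + A)) x‖ ≤ 4 * N₀ ∧
    ‖iteratedFDeriv ℝ 1 (fun y ↦ (h (y + A y)).bilinearComp (ContinuousLinearMap.id ℝ E4 + A)
        (ContinuousLinearMap.id ℝ E4 + A)) x‖ ≤ 8 * N₁ ∧
    ‖iteratedFDeriv ℝ 2 (fun y ↦ (h (y + A y)).bilinearComp (ContinuousLinearMap.id ℝ E4 + A)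
        (ContinuousLinearMap.id ℝ E4 + A)) x‖ ≤ 16 * N₂ := by
  have hG := contDiffAt_pullback hh hAx (A := A)
  have hN₀ : 0 ≤ N₀ := (norm_nonneg _).trans (h0 x hx)
  have hN₁ : 0 ≤ N₁ := (norm_nonneg _).trans (h1 x hx)
  have hN₂ : 0 ≤ N₂ := (norm_nonneg _).trans (h2 x hx)
  have ha := norm_nonneg A
  have hU : IsOpen (ball x r) := isOpen_ball
  set L := ContinuousLinearMap.id ℝ E4 + A with hL
  have hLv : ∀ v : E4, ‖L v‖ ≤ 2 * ‖v‖ := fun v ↦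
    (norm_id_add_apply_le A v).trans (by nlinarith [norm_nonneg v])
  -- the components are `ψ_{Lv,Lw}(y + Ay)`
  have hcomp : ∀ v w : E4, (fun y ↦ (h (y + A y)).bilinearComp L L v w) =
      fun y ↦ (fun z ↦ h z (L v) (L w)) (y + A y) := fun v w ↦ rfl
  -- sup bounds of the components (orders `1, 2`) from `scalar_sup_bounds` with dummy orders
  have hsup : ∀ v w : E4,
      (∀ z ∈ ball x r, ‖fderiv ℝ (fun z ↦ h z (L v) (L w)) z‖ ≤ N₁ * ‖L v‖ * ‖L w‖) ∧
      (∀ z ∈ ball x r, ‖fderiv ℝ (fderiv ℝ (fun z ↦ h z (L v) (L w))) z‖ ≤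
        N₂ * ‖L v‖ * ‖L w‖) := by
    intro v w
    refine ⟨fun z hz ↦ ?_, fun z hz ↦ ?_⟩
    · rw [← norm_iteratedFDeriv_one]
      calc _ ≤ ‖L v‖ * ‖L w‖ * ‖iteratedFDeriv ℝ 1 h z‖ :=
            norm_iteratedFDeriv_apply₂_le hh hz (L v) (L w) 1
        _ ≤ ‖L v‖ * ‖L w‖ * N₁ := by gcongr; exact h1 z hz
        _ = _ := by ring
    · rw [← norm_iteratedFDeriv_zero (𝕜 := ℝ) (f := fderiv ℝ (fderiv ℝ fun z ↦ h z (L v) (L w))),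
        norm_iteratedFDeriv_fderiv, norm_iteratedFDeriv_fderiv]
      calc _ ≤ ‖L v‖ * ‖L w‖ * ‖iteratedFDeriv ℝ 2 h z‖ :=
            norm_iteratedFDeriv_apply₂_le hh hz (L v) (L w) 2
        _ ≤ ‖L v‖ * ‖L w‖ * N₂ := by gcongr; exact h2 z hz
        _ = _ := by ring
  refine ⟨?_, ?_, ?_⟩
  · refine opNorm_le_bound₂ _ (by positivity) fun v w ↦ ?_
    calc ‖(h (x + A x)).bilinearComp L L v w‖ = ‖h (x + A x) (L v) (L w)‖ := rfl
      _ ≤ ‖h (x + A x)‖ * ‖L v‖ * ‖L w‖ := le_opNorm₂ _ _ _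
      _ ≤ N₀ * (2 * ‖v‖) * (2 * ‖w‖) := by
          gcongr
          · exact h0 _ hAx
          · exact hLv v
          · exact hLv w
      _ = 4 * N₀ * ‖v‖ * ‖w‖ := by ring
  · refine norm_iteratedFDeriv_le_of_forall_apply₂ (m := 1) (hG.of_le (WithTop.coe_le_coe.mpr le_top))
      (by positivity) fun v w ↦ ?_
    rw [hcomp, norm_iteratedFDeriv_one]
    have hb := norm_fderiv_comp_affine_le hU (contDiffOn_apply₂ hh (L v) (L w)) hAx (hsup v w).1
      (A := A)
    refine hb.trans ?_
    calc N₁ * ‖L v‖ * ‖L w‖ * (1 + ‖A‖) ≤ N₁ * (2 * ‖v‖) * (2 * ‖w‖) * 2 := by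
          gcongr
          · exact hLv v
          · exact hLv w
          · linarith
      _ = 8 * N₁ * ‖v‖ * ‖w‖ := by ring
  · refine norm_iteratedFDeriv_le_of_forall_apply₂ (m := 2) (hG.of_le (WithTop.coe_le_coe.mpr le_top))
      (by positivity) fun v w ↦ ?_
    rw [hcomp, ← norm_iteratedFDeriv_fderiv, norm_iteratedFDeriv_one]
    refine opNorm_le_bound₂ _ (by positivity) fun p q ↦ ?_
    have hb := norm_fderiv_fderiv_comp_affine_apply_le hU (contDiffOn_apply₂ hh (L v) (L w)) hAx
      (hsup v w).2 p q (A := A)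
    refine hb.trans ?_
    have h4 : (1 + ‖A‖) ^ 2 ≤ 4 := by nlinarith
    calc N₂ * ‖L v‖ * ‖L w‖ * (1 + ‖A‖) ^ 2 * ‖p‖ * ‖q‖
        ≤ N₂ * (2 * ‖v‖) * (2 * ‖w‖) * 4 * ‖p‖ * ‖q‖ := by
          gcongr
          · exact hLv v
          · exact hLv w
      _ = 16 * N₂ * ‖v‖ * ‖w‖ * ‖p‖ * ‖q‖ := by ring

/-- **Registered sub-goal form** (stub `dragDefect_pullback_jets` of the crux item) of
`norm_iteratedFDeriv_pullback_le`. [folklore] -/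
theorem dragDefect_pullback_jets : open Literature.Geometry.Lorentzian Metric in ∀ {h : E4 → E4 →L[ℝ] E4 →L[ℝ] ℝ} {A : E4 →L[ℝ] E4} {x : E4} {r N₀ N₁ N₂ : ℝ}, ContDiffOn ℝ ((⊤ : ℕ∞) : WithTop ℕ∞) h (ball x r) → x ∈ ball x r → x + A x ∈ ball x r → ‖A‖ ≤ 1 → (∀ z ∈ ball x r, ‖h z‖ ≤ N₀) → (∀ z ∈ ball x r, ‖iteratedFDeriv ℝ 1 h z‖ ≤ N₁) → (∀ z ∈ ball x r, ‖iteratedFDeriv ℝ 2 h z‖ ≤ N₂) → ‖(fun y ↦ (h (y + A y)).bilinearComp (ContinuousLinearMap.id ℝ E4 + A) (ContinuousLinearMap.id ℝ E4 + A)) x‖ ≤ 4 * N₀ ∧ ‖iteratedFDeriv ℝ 1 (fun y ↦ (h (y + A y)).bilinearComp (ContinuousLinearMap.id ℝ E4 + A) (ContinuousLinearMap.id ℝ E4 + A)) x‖ ≤ 8 * N₁ ∧ ‖iteratedFDeriv ℝ 2 (fun y ↦ (h (y + A y)).bilinearComp (ContinuousLinearMap.id ℝ E4 + A) (ContinuousLinearMap.id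 ℝ E4 + A)) x‖ ≤ 16 * N₂ :=
  fun hh hx hAx hA h0 h1 h2 ↦ norm_iteratedFDeriv_pullback_le hh hx hAx hA h0 h1 h2

end Pullback

end DragDefect

end Summit.FinalStateConjecture.FinalStateConjecture.Theorems

end
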